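import Summits.PneNP.PneNP.Theorems.ConvexRankGatesConvexGateBlindExactLiftingTriangleIsolationOffLine

/-!
# Triangle instance — THEOREM B: ε-uniform isolation of the line factorisation of `M_t`

Support file for crux `ConvexGateBlind` (stmt-PneNP-10680), line `xor-door-perfect-completeness`, open stub
`stub_exactLifting` (instance of record: the triangle matrix `M_t[x,w] = monoCount x w = 1 + 2·[x₀(w₀)=x₁(w₁)=x₂(w₂)]`,
`rk₊(M_t) ≤ 3t²` by the line factorisation `M_t = ∑_{L mono under x} 1_L`, `rk₊(M_t − J) = Θ(t³)`; the open question of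
record is the behaviour of `f_t(ε) = rk₊(M_t − εJ)` as `ε → 0⁺`). Prover seat 0, session 22, memo ANALYSIS12.

**Theorem B (`triangle_line_isolation`, registered sub-goal of stmt-PneNP-10680).** Let `t ≥ 3` and suppose
`M_t − εJ = ∑_L u_L ⊗ v_L`, a sum of `3t²` non-negative rank-one terms INDEXED BY THE LINES (in any way), normalised so that
each `v_L` has mean `1` on its own line. If every row function is uniformly `10⁻⁵`-close to the line pattern,
`|u_L(x) − [L monochromatic under x]| ≤ 10⁻⁵` for all `L, x`, then `ε ≤ 0` — whatever the column functions `v_L ≥ 0` are.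
So strict factorisations (`ε > 0`) of line size stay a fixed distance away from the line factorisation, UNIFORMLY IN `ε`
(every earlier bound on the instance degenerates as `ε → 0⁺`: `ε^{11} t³` by mass, `ε t³` by functionals). The theorem is
local (other `3t²`-term factorisations of `M_t` may exist for `t ≥ 4`) and does not bound `f_t(0⁺)` by itself.

Proof (files `…IsolationBlocks` ⟵ `…BlockBounds` ⟵ `…Kernel` ⟵ `…KernelTwo` ⟵ `…Identity` ⟵ `…OffLine` ⟵ this):
the cube-inequality dual `ψ^x` (weights `± N₀N₁N₂`) kills monochromatic lines and is `≥ 0` on bichromatic ones; applied to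
the factorisation expanded around the line pattern and summed over all rows it gives `A + B + C = −4ε M` where
`A = ∑ ker·Δ ≥ Kmin·S_off/128` because the usage-averaged kernel `ker L w = ∑_x [L mono] ψ^x(e_w)` is `0` ON the line and
`≳ t³ 8^t` OFF it (sign-definiteness — the heart of the matter), `B ≥ 0`, and `|C| ≤ η Fd³ (S_off + S_on)`; exactness at the
off points of each row, compared along a monochromatic line, bounds the on-line mass `S_on` by `S_off` and `B` (`…OffLine`);
for `η ≤ 10⁻⁵` the error is absorbed and `ε ≤ 0` follows (`isolation`).
-/

set_option linter.dupNamespace false -- `Summit.PneNP.PneNP.…`: summit = sub-problem (D-0017)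

namespace Summit.PneNP.PneNP.Theorems.XorDoor.TriLine

open Finset

noncomputable section

variable {t : ℕ} {ε η : ℝ} {u : Line t → Col t → ℝ} {v : Line t → Tri t → ℝ}

/-- **Master inequality.** For a line-labelled factorisation of `M_t − εJ` with rows `η`-close to the line pattern,
`η ≤ 10⁻⁵`, `t ≥ 3`: `ε ≤ 0`, and if `ε = 0` then `S_off = 0`, `B = 0` and `S_on = 0` (all the slack is gone). -/
theorem master (ht : 3 ≤ t) (h : IsLineFact t ε η u v) (hη : η ≤ 1 / 100000) :
    ε ≤ 0 ∧ (ε = 0 → Soff v = 0 ∧ Bq u = 0 ∧ Son v = 0) := by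
  -- the five inequalities
  have hId := identity h
  have hA := A_ge h
  obtain ⟨hB0, hB2⟩ := B_ge h
  have hC := C_le h
  have hO := muG_mul_Son_le h (by omega)
  have hη0 := h.eta_nonneg
  have hS1 := Soff_nonneg h
  have hS2 := Son_nonneg v
  have hBt := Bt_nonneg h
  -- constants in closed form: `T = t`, `a = t − 1`, `b = t − 2`, `P = 2^t`
  have hTpos : (0 : ℝ) < (t : ℝ) := by exact_mod_cast (show 0 < t by omega)
  have hapos : (0 : ℝ) < ((t - 1 : ℕ) : ℝ) := by exact_mod_cast (show 0 < t - 1 by omega)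
  have hbpos : (0 : ℝ) < ((t - 2 : ℕ) : ℝ) := by exact_mod_cast (show 0 < t - 2 by omega)
  have hPpos : (0 : ℝ) < (2 : ℝ) ^ t := by positivity
  have hT3b : (t : ℝ) ≤ 3 * ((t - 2 : ℕ) : ℝ) := by exact_mod_cast (show t ≤ 3 * (t - 2) by omega)
  have ha2b : ((t - 1 : ℕ) : ℝ) ≤ 2 * ((t - 2 : ℕ) : ℝ) := by exact_mod_cast (show t - 1 ≤ 2 * (t - 2) by omega)
  obtain ⟨T, hT⟩ : ∃ T : ℝ, T = (t : ℝ) := ⟨_, rfl⟩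
  obtain ⟨a, ha⟩ : ∃ a : ℝ, a = ((t - 1 : ℕ) : ℝ) := ⟨_, rfl⟩
  obtain ⟨b, hb⟩ : ∃ b : ℝ, b = ((t - 2 : ℕ) : ℝ) := ⟨_, rfl⟩
  obtain ⟨P, hP⟩ : ∃ P : ℝ, P = (2 : ℝ) ^ t := ⟨_, rfl⟩
  rw [← hT] at hTpos hT3b
  rw [← ha] at hapos ha2b
  rw [← hb] at hbpos hT3b ha2b
  rw [← hP] at hPpos
  have hK : Kmin t = a * b ^ 2 * P ^ 3 := by rw [Kmin, ← ha, ← hb, ← hP]; ring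
  have hF3 : Fd t ^ 3 = a ^ 3 * P ^ 3 / 8 := by rw [Fd, ← ha, ← hP]; ring
  have hTcp : Tcp t = T * a * P / 4 := by
    have := four_mul_Tcp t; rw [← hT, ← ha, ← hP] at this; linarith
  have hM : Mq t = T * (T ^ 2 * a ^ 3 * P ^ 3) / 64 := by rw [Mq_eq, hTcp]; ring
  have hG : muG t = b * (T ^ 2 * a ^ 3 * P ^ 3) / 1024 := by rw [muG, hTcp, ← ha, ← hb, ← hP]; ring
  have hQpos : 0 < T ^ 2 * a ^ 3 * P ^ 3 := mul_pos (mul_pos (pow_pos hTpos 2) (pow_pos hapos 3)) (pow_pos hPpos 3)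
  have haPpos : 0 < a * P ^ 3 := mul_pos hapos (pow_pos hPpos 3)
  -- the three ratio inequalities
  have hTQ : T * (T ^ 2 * a ^ 3 * P ^ 3) ≤ (3 * b) * (T ^ 2 * a ^ 3 * P ^ 3) :=
    mul_le_mul_of_nonneg_right hT3b hQpos.le
  have F1 : Mq t ≤ 48 * muG t := by rw [hM, hG]; linarith
  have F2 : T ^ 3 * Fd t ^ 3 ≤ 384 * muG t := by
    rw [hF3, hG]
    have e : T ^ 3 * (a ^ 3 * P ^ 3 / 8) = T * (T ^ 2 * a ^ 3 * P ^ 3) / 8 := by ring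
    rw [e]; linarith
  have F3 : 2 * Fd t ^ 3 ≤ Kmin t := by
    rw [hF3, hK]
    have h1 : a ^ 2 ≤ (2 * b) ^ 2 := by gcongr
    have h2 : a ^ 2 * (a * P ^ 3) ≤ (2 * b) ^ 2 * (a * P ^ 3) := mul_le_mul_of_nonneg_right h1 haPpos.le
    have e1 : 2 * (a ^ 3 * P ^ 3 / 8) = a ^ 2 * (a * P ^ 3) / 4 := by ring
    have e2 : a * b ^ 2 * P ^ 3 = (2 * b) ^ 2 * (a * P ^ 3) / 4 := by ring
    rw [e1, e2]; linarith
  have hGpos : 0 < muG t := by rw [hG]; exact div_pos (mul_pos hbpos hQpos) (by norm_num)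
  have hMpos : 0 < Mq t := by rw [hM]; exact div_pos (mul_pos hTpos hQpos) (by norm_num)
  have hF3nn : 0 ≤ Fd t ^ 3 := by rw [hF3]; exact div_nonneg (mul_nonneg (pow_nonneg hapos.le 3) (pow_nonneg hPpos.le 3)) (by norm_num)
  have hKnn : 0 ≤ Kmin t := by linarith [F3, hF3nn]
  -- (S): the on-line mass in terms of the off-line mass and `B̃`
  have m1 : Mq t * Soff v ≤ 48 * muG t * Soff v := mul_le_mul_of_nonneg_right F1 hS1
  have m2 : Mq t * Son v ≤ 48 * muG t * Son v := mul_le_mul_of_nonneg_right F1 hS2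
  have m3 : η * (Mq t * Soff v) ≤ η * (48 * muG t * Soff v) := mul_le_mul_of_nonneg_left m1 hη0
  have m4 : η * (Mq t * Son v) ≤ η * (48 * muG t * Son v) := mul_le_mul_of_nonneg_left m2 hη0
  have m5 : η * (muG t * Soff v) ≤ (1 / 100000) * (muG t * Soff v) :=
    mul_le_mul_of_nonneg_right hη (mul_nonneg hGpos.le hS1)
  have m6 : η * (muG t * Son v) ≤ (1 / 100000) * (muG t * Son v) :=
    mul_le_mul_of_nonneg_right hη (mul_nonneg hGpos.le hS2)
  have n3 : 0 ≤ muG t * Soff v := mul_nonneg hGpos.le hS1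
  have n4 : 0 ≤ T * Bt u := mul_nonneg hTpos.le hBt
  have hS : muG t * Son v ≤ 577 * muG t * Soff v + 12 * T * Bt u := by
    rw [← hT] at hO; linarith
  -- main inequality from the identity
  have main1 : 512 * ε * Mq t ≤ -Kmin t * Soff v - 128 * Bq u + 128 * η * Fd t ^ 3 * (Soff v + Son v) := by
    have := neg_le_abs (Cq u v)
    linarith
  -- clearing denominators: multiply by `T² μ₀`, substitute (S), `T³ F ≤ 384 μ₀`, `2F ≤ K`, `2 B̃ ≤ T² B`
  have hTG : 0 ≤ T ^ 2 * muG t := mul_nonneg (sq_nonneg T) hGpos.le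
  have q1 : T ^ 2 * muG t * (512 * ε * Mq t)
      ≤ T ^ 2 * muG t * (-Kmin t * Soff v - 128 * Bq u + 128 * η * Fd t ^ 3 * (Soff v + Son v)) :=
    mul_le_mul_of_nonneg_left main1 hTG
  have q2 : 128 * η * T ^ 2 * Fd t ^ 3 * (muG t * Son v)
      ≤ 128 * η * T ^ 2 * Fd t ^ 3 * (577 * muG t * Soff v + 12 * T * Bt u) :=
    mul_le_mul_of_nonneg_left hS (by
      have := mul_nonneg (mul_nonneg (mul_nonneg (by norm_num : (0 : ℝ) ≤ 128) hη0) (sq_nonneg T)) hF3nn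
      exact this)
  have q3 : η * (T ^ 3 * Fd t ^ 3 * Bt u) ≤ η * (384 * muG t * Bt u) :=
    mul_le_mul_of_nonneg_left (mul_le_mul_of_nonneg_right F2 hBt) hη0
  have q4 : η * T ^ 2 * muG t * (2 * Fd t ^ 3 * Soff v) ≤ η * T ^ 2 * muG t * (Kmin t * Soff v) :=
    mul_le_mul_of_nonneg_left (mul_le_mul_of_nonneg_right F3 hS1) (mul_nonneg (mul_nonneg hη0 (sq_nonneg T)) hGpos.le)
  have n1 : 0 ≤ T ^ 2 * muG t * Kmin t * Soff v := mul_nonneg (mul_nonneg hTG hKnn) hS1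
  have q6 : η * (T ^ 2 * muG t * Kmin t * Soff v) ≤ (1 / 100000) * (T ^ 2 * muG t * Kmin t * Soff v) :=
    mul_le_mul_of_nonneg_right hη n1
  rw [← hT] at hB2
  have q5 : η * muG t * (2 * Bt u) ≤ η * muG t * (T ^ 2 * Bq u) :=
    mul_le_mul_of_nonneg_left hB2 (mul_nonneg hη0 hGpos.le)
  have n2 : 0 ≤ muG t * T ^ 2 * Bq u := mul_nonneg (mul_nonneg hGpos.le (sq_nonneg T)) hB0
  have q7 : η * (muG t * T ^ 2 * Bq u) ≤ (1 / 100000) * (muG t * T ^ 2 * Bq u) :=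
    mul_le_mul_of_nonneg_right hη n2
  -- MASTER: `512 T²μ₀M·ε + (63/100) T²μ₀K·S_off + 125 T²μ₀·B ≤ 0`
  have hmaster : (T ^ 2 * muG t * Mq t * 512) * ε + (63 / 100) * (T ^ 2 * muG t * Kmin t * Soff v)
      + 125 * (muG t * T ^ 2 * Bq u) ≤ 0 := by
    linarith [q1, q2, q3, q4, q5, q6, q7, n1, n2]
  have hcoef : 0 < T ^ 2 * muG t * Mq t * 512 :=
    mul_pos (mul_pos (mul_pos (pow_pos hTpos 2) hGpos) hMpos) (by norm_num : (0 : ℝ) < 512)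
  refine ⟨?_, fun hε => ?_⟩
  · have hfin : (T ^ 2 * muG t * Mq t * 512) * ε ≤ (T ^ 2 * muG t * Mq t * 512) * 0 := by linarith
    exact le_of_mul_le_mul_left hfin hcoef
  · rw [hε, mul_zero, zero_add] at hmaster
    have hKpos : 0 < Kmin t := by rw [hK]; exact mul_pos (mul_pos hapos (pow_pos hbpos 2)) (pow_pos hPpos 3)
    have h1 : T ^ 2 * muG t * Kmin t * Soff v = 0 := by linarith
    have hS1z : Soff v = 0 := by
      rcases mul_eq_zero.mp h1 with h2 | h2
      · exfalso; exact (mul_pos (mul_pos (pow_pos hTpos 2) hGpos) hKpos).ne' h2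
      · exact h2
    have h3 : muG t * T ^ 2 * Bq u = 0 := by linarith
    have hQz : Bq u = 0 := by
      rcases mul_eq_zero.mp h3 with h4 | h4
      · exfalso; exact (mul_pos hGpos (pow_pos hTpos 2)).ne' h4
      · exact h4
    have hBtz : Bt u = 0 := by
      have : 2 * Bt u ≤ 0 := by rw [hQz, mul_zero] at hB2; exact hB2
      linarith
    have h5 : muG t * Son v = 0 := by
      have : muG t * Son v ≤ 0 := by rw [hS1z, hBtz] at hS; linarith
      have : 0 ≤ muG t * Son v := mul_nonneg hGpos.le hS2
      linarith
    have hS2z : Son v = 0 := by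
      rcases mul_eq_zero.mp h5 with h6 | h6
      · exfalso; exact hGpos.ne' h6
      · exact h6
    exact ⟨hS1z, hQz, hS2z⟩

/-- **Isolation (abstract form).** A line-labelled factorisation of `M_t − εJ` with rows `η`-close to the line pattern,
`η ≤ 10⁻⁵`, `t ≥ 3`, has `ε ≤ 0`. -/
theorem isolation (ht : 3 ≤ t) (h : IsLineFact t ε η u v) (hη : η ≤ 1 / 100000) : ε ≤ 0 := (master ht h hη).1

/-- **Local rigidity (abstract form).** At `ε = 0`: a line-labelled `3t²`-term factorisation of `M_t` itself with rows
`η`-close to the line pattern (`η ≤ 10⁻⁵`, `t ≥ 3`) has EXACTLY the line indicators as its (normalised) column functions. -/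
theorem rigidity (ht : 3 ≤ t) (h : IsLineFact t 0 η u v) (hη : η ≤ 1 / 100000) : ∀ L w, v L w = lind L w := by
  obtain ⟨hS1, -, hS2⟩ := (master ht h hη).2 rfl
  intro L w
  have h1 : (1 - lind L w) * Dfn v L w = 0 := by
    have hnn : ∀ L' ∈ (univ : Finset (Line t)), 0 ≤ ∑ w' : Tri t, (1 - lind L' w') * Dfn v L' w' := by
      intro L' _
      refine sum_nonneg fun w' _ => ?_
      by_cases hm : lmem L' w'
      · rw [lind_of_lmem hm]; simp
      · rw [lind_of_not_lmem hm]; simpa using Dfn_nonneg_of_not_lmem h hm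
    have hL := (sum_eq_zero_iff_of_nonneg hnn).mp hS1 L (mem_univ L)
    have hnn' : ∀ w' ∈ (univ : Finset (Tri t)), 0 ≤ (1 - lind L w') * Dfn v L w' := by
      intro w' _
      by_cases hm : lmem L w'
      · rw [lind_of_lmem hm]; simp
      · rw [lind_of_not_lmem hm]; simpa using Dfn_nonneg_of_not_lmem h hm
    exact (sum_eq_zero_iff_of_nonneg hnn').mp hL w (mem_univ w)
  have h2 : lind L w * |Dfn v L w| = 0 := by
    have hnn : ∀ L' ∈ (univ : Finset (Line t)), 0 ≤ ∑ w' : Tri t, lind L' w' * |Dfn v L' w'| :=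
      fun L' _ => sum_nonneg fun w' _ => mul_nonneg (lind_nonneg L' w') (abs_nonneg _)
    have hL := (sum_eq_zero_iff_of_nonneg hnn).mp hS2 L (mem_univ L)
    exact (sum_eq_zero_iff_of_nonneg (fun w' _ => mul_nonneg (lind_nonneg L w') (abs_nonneg _))).mp hL w (mem_univ w)
  have h3 : Dfn v L w = 0 := by
    by_cases hm : lmem L w
    · rw [lind_of_lmem hm, one_mul] at h2; exact abs_eq_zero.mp h2
    · rw [lind_of_not_lmem hm, sub_zero, one_mul] at h1; exact h1
  unfold Dfn at h3
  linarith

/-! ## The registered form: three families of row and column functions, one per direction -/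

/-- summing against the indicator of a line `{(p,q,·)}` -/
lemma sum_lind_mul_inl (f : Tri t → ℝ) (p q : Fin t) :
    ∑ w : Tri t, lind (Sum.inl (p, q)) w * f w = ∑ d, f (p, q, d) := by
  unfold lind
  rw [Fintype.sum_prod_type, Fintype.sum_eq_single p]
  · rw [Fintype.sum_prod_type, Fintype.sum_eq_single q]
    · exact sum_congr rfl fun d _ => by simp
    · intro q' hq'; exact sum_eq_zero fun d _ => by simp [hq']
  · intro p' hp'; exact sum_eq_zero fun qd _ => by simp [hp']

/-- summing against the indicator of a line `{(p,·,q)}` -/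
lemma sum_lind_mul_inr_inl (f : Tri t → ℝ) (p q : Fin t) :
    ∑ w : Tri t, lind (Sum.inr (Sum.inl (p, q))) w * f w = ∑ d, f (p, d, q) := by
  unfold lind
  rw [Fintype.sum_prod_type, Fintype.sum_eq_single p]
  · rw [Fintype.sum_prod_type]
    refine sum_congr rfl fun b _ => ?_
    rw [Fintype.sum_eq_single q]
    · simp
    · intro q' hq'; simp [hq']
  · intro p' hp'; exact sum_eq_zero fun qd _ => by simp [hp']

/-- summing against the indicator of a line `{(·,p,q)}` -/
lemma sum_lind_mul_inr_inr (f : Tri t → ℝ) (p q : Fin t) :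
    ∑ w : Tri t, lind (Sum.inr (Sum.inr (p, q))) w * f w = ∑ d, f (d, p, q) := by
  unfold lind
  rw [Fintype.sum_prod_type]
  refine sum_congr rfl fun a _ => ?_
  rw [Fintype.sum_eq_single (p, q)]
  · simp
  · rintro ⟨b', d'⟩ hne
    rw [if_neg]
    · ring
    · rintro ⟨hb, hd⟩
      simp only at hb hd
      exact hne (by rw [hb, hd])

/-- **THEOREM B — ε-uniform isolation of the line factorisation of the triangle matrix** (registered sub-goal
`triangle_line_isolation` of stmt-PneNP-10680, verbatim signature). Rows `x ∈ (Fin t → Bool)³`, columns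
`w ∈ (Fin t)³`, `M_t[x,w]` = number of monochromatic edges of the transversal triangle `w` (the three `if`s). The `3t²`
rank-one terms are indexed by the lines: `u₁₂ a b ⊗ v₁₂ a b` for the line `{(a,b,·)}`, `u₁₃ a b ⊗ v₁₃ a b` for `{(a,·,b)}`,
`u₂₃ a b ⊗ v₂₃ a b` for `{(·,a,b)}`; each column function sums to `t` on its own line (mean `1` — for a factorisation whose
column functions do not vanish identically on their lines this is a rescaling `(u,v) ↦ (n·u, v/n)`, and the closeness
hypothesis is then on the rescaled rows). Conclusion: if every row function is within `10⁻⁵` of the line pattern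
(`[x₀ a = x₁ b]`, `[x₀ a = x₂ b]`, `[x₁ a = x₂ b]` respectively), uniformly in `x`, the shift `ε` cannot be positive. -/
theorem triangle_line_isolation : ∀ (t : ℕ), 3 ≤ t → ∀ (ε : ℝ) (u₁₂ u₁₃ u₂₃ : Fin t → Fin t → (Fin t → Bool) × (Fin t →
    Bool) × (Fin t → Bool) → ℝ) (v₁₂ v₁₃ v₂₃ : Fin t → Fin t → Fin t × Fin t × Fin t → ℝ), (∀ a b x, 0 ≤ u₁₂ a b x ∧ 0 ≤
    u₁₃ a b x ∧ 0 ≤ u₂₃ a b x) → (∀ a b w, 0 ≤ v₁₂ a b w ∧ 0 ≤ v₁₃ a b w ∧ 0 ≤ v₂₃ a b w) → (∀ x w, ∑ a, ∑ b, (u₁₂ a b x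
    * v₁₂ a b w + u₁₃ a b x * v₁₃ a b w + u₂₃ a b x * v₂₃ a b w) = ((if x.1 w.1 = x.2.1 w.2.1 then 1 else 0) + (if x.1 w.1
    = x.2.2 w.2.2 then 1 else 0) + (if x.2.1 w.2.1 = x.2.2 w.2.2 then 1 else 0) : ℝ) - ε) → (∀ a b, ∑ d, v₁₂ a b (a, b, d)
    = t ∧ ∑ d, v₁₃ a b (a, d, b) = t ∧ ∑ d, v₂₃ a b (d, a, b) = t) → (∀ a b x, |u₁₂ a b x - (if x.1 a = x.2.1 b then 1
    else 0)| ≤ 1 / 100000 ∧ |u₁₃ a b x - (if x.1 a = x.2.2 b then 1 else 0)| ≤ 1 / 100000 ∧ |u₂₃ a b x - (if x.2.1 a =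
    x.2.2 b then 1 else 0)| ≤ 1 / 100000) → ε ≤ 0 := by
  intro t ht ε u₁₂ u₁₃ u₂₃ v₁₂ v₁₃ v₂₃ hu hv hfact hnorm hclose
  have hLF : IsLineFact t ε (1 / 100000)
      (fun L => Sum.elim (fun ab => u₁₂ ab.1 ab.2) (Sum.elim (fun ad => u₁₃ ad.1 ad.2) (fun bd => u₂₃ bd.1 bd.2)) L)
      (fun L => Sum.elim (fun ab => v₁₂ ab.1 ab.2) (Sum.elim (fun ad => v₁₃ ad.1 ad.2) (fun bd => v₂₃ bd.1 bd.2)) L) := by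
    refine ⟨?_, ?_, ?_, ?_, by norm_num, ?_⟩
    · rintro (⟨a, b⟩ | ⟨a, d⟩ | ⟨b, d⟩) x
      · exact (hu a b x).1
      · exact (hu a d x).2.1
      · exact (hu b d x).2.2
    · rintro (⟨a, b⟩ | ⟨a, d⟩ | ⟨b, d⟩) w
      · exact (hv a b w).1
      · exact (hv a d w).2.1
      · exact (hv b d w).2.2
    · intro x w
      have hf := hfact x w
      simp only [sum_add_distrib] at hf
      rw [Fintype.sum_sum_type, Fintype.sum_sum_type]
      simp only [Sum.elim_inl, Sum.elim_inr, Fintype.sum_prod_type, monoCount]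
      push_cast
      linarith [hf]
    · rintro (⟨a, b⟩ | ⟨a, d⟩ | ⟨b, d⟩)
      · rw [sum_lind_mul_inl]; exact (hnorm a b).1
      · rw [sum_lind_mul_inr_inl]; exact (hnorm a d).2.1
      · rw [sum_lind_mul_inr_inr]; exact (hnorm b d).2.2
    · rintro (⟨a, b⟩ | ⟨a, d⟩ | ⟨b, d⟩) x
      · exact (hclose a b x).1
      · exact (hclose a d x).2.1
      · exact (hclose b d x).2.2
  exact isolation ht hLF le_rfl

/-- **THEOREM B′ — local rigidity of the line factorisation of the triangle matrix** (registered sub-goal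
`triangle_line_rigidity` of stmt-PneNP-10680, verbatim signature). Same setting as `triangle_line_isolation` but for
`M_t` ITSELF (`ε = 0`): if `M_t = ∑_L u_L ⊗ v_L` with `3t²` terms indexed by the lines, each `v_L` summing to `t` on its own
line, and every row function within `10⁻⁵` of the line pattern uniformly in `x` (`t ≥ 3`), then every column function IS the
indicator of its line. With Theorem B: near the line point there is no other exact factorisation of line size, at `ε = 0` nor
at any `ε > 0` — the cheap corner is an isolated point, ε-uniformly. (Global rigidity, i.e. without the closeness hypothesis, is
the open question R1 of ANALYSIS12; it fails for `t ≤ 3`, where the `t³ ≤ 3t²` points also factorise `M_t`.) -/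
theorem triangle_line_rigidity : ∀ (t : ℕ), 3 ≤ t → ∀ (u₁₂ u₁₃ u₂₃ : Fin t → Fin t → (Fin t → Bool) × (Fin t → Bool) ×
    (Fin t → Bool) → ℝ) (v₁₂ v₁₃ v₂₃ : Fin t → Fin t → Fin t × Fin t × Fin t → ℝ), (∀ a b x, 0 ≤ u₁₂ a b x ∧ 0 ≤ u₁₃ a b
    x ∧ 0 ≤ u₂₃ a b x) → (∀ a b w, 0 ≤ v₁₂ a b w ∧ 0 ≤ v₁₃ a b w ∧ 0 ≤ v₂₃ a b w) → (∀ x w, ∑ a, ∑ b, (u₁₂ a b x * v₁₂ a b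
    w + u₁₃ a b x * v₁₃ a b w + u₂₃ a b x * v₂₃ a b w) = ((if x.1 w.1 = x.2.1 w.2.1 then 1 else 0) + (if x.1 w.1 = x.2.2
    w.2.2 then 1 else 0) + (if x.2.1 w.2.1 = x.2.2 w.2.2 then 1 else 0) : ℝ)) → (∀ a b, ∑ d, v₁₂ a b (a, b, d) = t ∧ ∑ d,
    v₁₃ a b (a, d, b) = t ∧ ∑ d, v₂₃ a b (d, a, b) = t) → (∀ a b x, |u₁₂ a b x - (if x.1 a = x.2.1 b then 1 else 0)| ≤ 1 /
    100000 ∧ |u₁₃ a b x - (if x.1 a = x.2.2 b then 1 else 0)| ≤ 1 / 100000 ∧ |u₂₃ a b x - (if x.2.1 a = x.2.2 b then 1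
    else 0)| ≤ 1 / 100000) → ∀ a b w, v₁₂ a b w = (if w.1 = a ∧ w.2.1 = b then 1 else 0) ∧ v₁₃ a b w = (if w.1 = a ∧
    w.2.2 = b then 1 else 0) ∧ v₂₃ a b w = (if w.2.1 = a ∧ w.2.2 = b then 1 else 0) := by
  intro t ht u₁₂ u₁₃ u₂₃ v₁₂ v₁₃ v₂₃ hu hv hfact hnorm hclose
  have hLF : IsLineFact t 0 (1 / 100000)
      (fun L => Sum.elim (fun ab => u₁₂ ab.1 ab.2) (Sum.elim (fun ad => u₁₃ ad.1 ad.2) (fun bd => u₂₃ bd.1 bd.2)) L)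
      (fun L => Sum.elim (fun ab => v₁₂ ab.1 ab.2) (Sum.elim (fun ad => v₁₃ ad.1 ad.2) (fun bd => v₂₃ bd.1 bd.2)) L) := by
    refine ⟨?_, ?_, ?_, ?_, by norm_num, ?_⟩
    · rintro (⟨a, b⟩ | ⟨a, d⟩ | ⟨b, d⟩) x
      · exact (hu a b x).1
      · exact (hu a d x).2.1
      · exact (hu b d x).2.2
    · rintro (⟨a, b⟩ | ⟨a, d⟩ | ⟨b, d⟩) w
      · exact (hv a b w).1
      · exact (hv a d w).2.1
      · exact (hv b d w).2.2
    · intro x w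
      have hf := hfact x w
      simp only [sum_add_distrib] at hf
      rw [Fintype.sum_sum_type, Fintype.sum_sum_type, sub_zero]
      simp only [Sum.elim_inl, Sum.elim_inr, Fintype.sum_prod_type, monoCount]
      push_cast
      linarith [hf]
    · rintro (⟨a, b⟩ | ⟨a, d⟩ | ⟨b, d⟩)
      · rw [sum_lind_mul_inl]; exact (hnorm a b).1
      · rw [sum_lind_mul_inr_inl]; exact (hnorm a d).2.1
      · rw [sum_lind_mul_inr_inr]; exact (hnorm b d).2.2
    · rintro (⟨a, b⟩ | ⟨a, d⟩ | ⟨b, d⟩) x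
      · exact (hclose a b x).1
      · exact (hclose a d x).2.1
      · exact (hclose b d x).2.2
  have hr := rigidity ht hLF le_rfl
  intro a b w
  refine ⟨?_, ?_, ?_⟩
  · have := hr (Sum.inl (a, b)) w; unfold lind at this; simpa using this
  · have := hr (Sum.inr (Sum.inl (a, b))) w; unfold lind at this; simpa using this
  · have := hr (Sum.inr (Sum.inr (a, b))) w; unfold lind at this; simpa using this

end

end Summit.PneNP.PneNP.Theorems.XorDoor.TriLine
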